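/-
Copyright (c) 2026 the pub-hodgecm-mathlib formalisation cell (harness21).  Prover seat hodgecm-mathlib-F0P2-p08 (g2), Track B «K2-LIT»,
#184♮ = hLiu418 = `stmt-HodgeConjecture-24832`; socket #41 `sig_K2LiuSiegelEisensteinContinuation`, KIND W, (x-a) STAGE «LOCAL», second letter: the half-plane identity
`hPart` of ★ `K2LiuSiegelEisensteinKindWEulerLetters.exists_kindW_eulerLetters_of_letters` REDUCED to genuinely local letters (Σ⊗ structure of the `T`-part, summand
integrability, «continued = integral» per summand and place) by ★ `K2LiuSiegelEisensteinKindWPartFubini`.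
THEOREMS ONLY (no `def`, no `instance`, no notation, no named-fact hypothesis, no `sorry`).
-/
import Summits.HodgeConjecture.HodgeConjecture.Theorems.K2LiuSiegelEisensteinKindWLetters           -- ★ (x-a) ED. 1–2 (`kindWFinset`, `kindWPart`; imports ★ `KindWPartFubini`)
import Summits.HodgeConjecture.HodgeConjecture.Theorems.K2LiuSiegelEisensteinWhittakerFactorLetters  -- ★ frame of the TOP's KIND-W block (`skewMatrices`, `gramR`)
import HarnessLib

/-!
# Crux `HLiu418`, socket #41, KIND W — `K2LiuSiegelEisensteinKindWPartOfLetters`: THE LETTER `hPart` («`I_{U(S,h)} = Σ_j F♯_{∞,j} · ∏_{v∈U(S,h)} F♯_{v,j}` ON THE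
# HALF-PLANE») FROM THE Σ⊗ STRUCTURE OF THE `T`-PART AND «CONTINUED = INTEGRAL» PER SUMMAND AND PLACE

Cell `hodgecm-mathlib`, crux item hLiu418 = `stmt-HodgeConjecture-24832`, route of record `HCCMUnconditional`; squad K2 ∕ K2Liu, road `K2_Liu`, socket #41; KIND W
(x-a) (F0P2-p08 lineage).  ★ `exists_kindW_eulerLetters_of_letters` ((x-a) ED. 3 STAGE «ASSEMBLY») takes ONE half-plane identity `hPart` BY VALUE.  THIS FILE reduces it to
its three LOCAL constituents (lane `--supports stmt-HodgeConjecture-24832`, count-neutral helper):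
* §1 **`kindWPart_eq_sum_mul_prod_of_letters`** — ONE index `S ∈ M_n(L)`, one `h`, one `s`: if the `T`-part at `T := kindWFinset T₀ S h` is a finite sum of pure tensors
  `fT_s(a,x) = Σ_j F_{∞,j}(s)(a)·∏_{v∈T} F_{v,j}(s)(x_v)` (`hsum`, (E3-a)) with integrable summands (`hint`), and the numbers `Finf j`, `Ffin j v` ARE the archimedean ∕ local
  Whittaker INTEGRALS of the summands at `s` (`hFinf`, `hFfin` — «continued = integral», (E3-b)(E3-c)), then
  `kindWPart T (νinf T) νv (fT T) S s h = Σ_j Finf j · ∏_{v∈T} Ffin j v` — ★ `jointWhittaker_eq_sum_mul_prod_of_sum_tensor` + Mathlib `Finset.prod_coe_sort`.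
* §2 **`hPart_of_letters`** — the `hPart` binder of ★ `exists_kindW_eulerLetters_of_letters` VERBATIM (skew index `S`, `n∕2 < re s`, `det ↑S ≠ 0`) from the ∀-quantified
  versions of the three local letters.
HONEST LABEL.  Count-neutral helper; it retires nothing by itself: `HC_CM` is proved only modulo the 7 printed citations (2 remaining named inputs:
hLiu418 = `stmt-HodgeConjecture-24832`, h413 = `stmt-HodgeConjecture-24833`) until rung 0 closes.

## References
* [KudlaRallis1994] S. Kudla, S. Rallis, Ann. of Math. 140 (1994): §1.   * [Tan1999] V. Tan, Canad. J. Math. 51 (1999): §2–§3.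
* [CasselsFrohlichANT1967] Cassels–Fröhlich (eds.), *Algebraic Number Theory* (1967): Ch. XV (Tate) §3.3.
-/

set_option autoImplicit false
-- the mandated namespace repeats the single-problem summit's segment (`HodgeConjecture.HodgeConjecture`)
set_option linter.dupNamespace false

noncomputable section

open scoped Matrix RestrictedProduct ENNReal NNReal Topology ComplexConjugate BigOperators
open NumberField IsDedekindDomain MeasureTheory Measure Filter Set

namespace Summit.HodgeConjecture.HodgeConjecture.Cruxes.HLiu418.K2LiuSiegelEisensteinKindWPartOfLetters

open Literature.NumberTheory.Automorphic Literature.NumberTheory.GaloisRepresentations Literature.NumberTheory.LFunctions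
open Literature.NumberTheory.GelbartRogawski1991 Literature.NumberTheory.GelbartRogawski1991.GRConstruction
open Literature.NumberTheory.K2Lit.SiegelDoubled
open Literature.NumberTheory.K2Lit.PlaceSplitting
open Literature.MeasureTheory.RestrictedProduct
open Summit.HodgeConjecture.HodgeConjecture.Cruxes.HLiu418.K2LiuSiegelUnipotentLocalDefs
open Summit.HodgeConjecture.HodgeConjecture.Cruxes.HLiu418.K2LiuSiegelUnipotentSplitDefs
open Summit.HodgeConjecture.HodgeConjecture.Cruxes.HLiu418.K2LiuSiegelUnipotentSplitAtDefs
open Summit.HodgeConjecture.HodgeConjecture.Cruxes.HLiu418.K2LiuSiegelUnipotentFourierDefs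
open Summit.HodgeConjecture.HodgeConjecture.Cruxes.HLiu418.K2LiuSiegelEisensteinKindWLetters
open Summit.HodgeConjecture.HodgeConjecture.Cruxes.HLiu418.K2LiuSiegelEisensteinKindWPartFubini (jointWhittaker_eq_sum_mul_prod_of_sum_tensor)

variable (L : Type) [Field L] [NumberField L] [IsCMField L]
variable {N M n : ℕ} (e : Fin N × Fin M ≃ Fin n)
  (dV : Fin N → L) (hdV : ∀ i, IsCMField.complexConj L (dV i) = dV i)
  (dW : Fin M → L) (hdW : ∀ i, IsCMField.complexConj L (dW i) = dW i)
  [MeasurableSpace ↥(unipDeltaArch L e dV hdV dW hdW)]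
  [∀ v : HeightOneSpectrum (𝓞 (Fp L)), MeasurableSpace ↥(unipDeltaLoc L e dV hdV dW hdW v)]

/-! ## §1 One index, one point, one parameter -/

set_option maxHeartbeats 400000 in -- MEASURED (as ★ `jointWhittaker_eq_sum_mul_prod_of_sum_tensor`, whose statement this one instantiates: the default 200 000 fails at `isDefEq`, 400 000 passes)
/-- **`I_T(S,s,h) = Σ_j Finf j · ∏_{v∈T} Ffin j v` FROM THE LOCAL LETTERS** (`T = kindWFinset T₀ S h`): Σ⊗ structure `hsum` + summand integrability `hint` (★ Fubini
`jointWhittaker_eq_sum_mul_prod_of_sum_tensor`) + «continued = integral» at `s` for each summand's archimedean (`hFinf`) and local (`hFfin`) factor.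
[cite: KudlaRallis1994, §1] [cite: Tan1999, §2–§3] [cite: CasselsFrohlichANT1967, Ch. XV §3.3] -/
theorem kindWPart_eq_sum_mul_prod_of_letters (T₀ : Finset (HeightOneSpectrum (𝓞 (Fp L))))
    (νinf : Finset (HeightOneSpectrum (𝓞 (Fp L))) → Measure ↥(unipDeltaArch L e dV hdV dW hdW)) (hσ : ∀ T, SigmaFinite (νinf T))
    (νv : ∀ v : HeightOneSpectrum (𝓞 (Fp L)), Measure ↥(unipDeltaLoc L e dV hdV dW hdW v)) [∀ v, SigmaFinite (νv v)]
    {fT : ∀ T : Finset (HeightOneSpectrum (𝓞 (Fp L))), ℂ → UnitaryGroup.arch (Fp L) L (IsCMField.complexConj L) (n + n) (hermD L e dV hdV dW hdW) × (Π v : T, UnitaryGroup.localPi L (IsCMField.complexConj L) (n + n) (hermD L e dV hdV dW hdW) v.1) → ℂ}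
    (S : Matrix (Fin n) (Fin n) L) (h : HA L e dV hdV dW hdW) (s : ℂ)
    {m : ℕ} {FinfT : Fin m → ℂ → UnitaryGroup.arch (Fp L) L (IsCMField.complexConj L) (n + n) (hermD L e dV hdV dW hdW) → ℂ} {FvT : Fin m → ∀ v : (kindWFinset L e dV hdV dW hdW T₀ S h), ℂ → UnitaryGroup.localPi L (IsCMField.complexConj L) (n + n) (hermD L e dV hdV dW hdW) v.1 → ℂ}
    (hsum : ∀ (s : ℂ) (a : UnitaryGroup.arch (Fp L) L (IsCMField.complexConj L) (n + n) (hermD L e dV hdV dW hdW)) (x : Π v : (kindWFinset L e dV hdV dW hdW T₀ S h), UnitaryGroup.localPi L (IsCMField.complexConj L) (n + n) (hermD L e dV hdV dW hdW) v.1),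
      fT (kindWFinset L e dV hdV dW hdW T₀ S h) s (a, x) = ∑ j, FinfT j s a * ∏ v : (kindWFinset L e dV hdV dW hdW T₀ S h), FvT j v s (x v))
    (hint : ∀ j, Integrable (fun p : ↥(unipDeltaArch L e dV hdV dW hdW) × (Π v : (kindWFinset L e dV hdV dW hdW T₀ S h), ↥(unipDeltaLoc L e dV hdV dW hdW v.1)) =>
      (conj (unipDeltaChar L e dV hdV dW hdW S
            (UnitaryGroup.archToAdelic (Fp L) L (IsCMField.complexConj L) (n + n) (hermD L e dV hdV dW hdW)
              (p.1 : UnitaryGroup.arch (Fp L) L (IsCMField.complexConj L) (n + n) (hermD L e dV hdV dW hdW))) : ℂ) *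
          ∏ v : (kindWFinset L e dV hdV dW hdW T₀ S h), conj (unipDeltaChar L e dV hdV dW hdW S
            (locToAdelic L e dV hdV dW hdW v.1
              ((p.2 v : ↥(unipDeltaLoc L e dV hdV dW hdW v.1)) : UnitaryGroup.localPi L (IsCMField.complexConj L) (n + n) (hermD L e dV hdV dW hdW) v.1)) : ℂ)) *
        (FinfT j s (UnitaryGroup.archPart (Fp L) L (IsCMField.complexConj L) (n + n) (hermD L e dV hdV dW hdW) (weylDelta L e dV hdV dW hdW) *
              (p.1 : UnitaryGroup.arch (Fp L) L (IsCMField.complexConj L) (n + n) (hermD L e dV hdV dW hdW)) *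
              UnitaryGroup.archPart (Fp L) L (IsCMField.complexConj L) (n + n) (hermD L e dV hdV dW hdW) h) *
          ∏ v : (kindWFinset L e dV hdV dW hdW T₀ S h), FvT j v s (UnitaryGroup.evalPlace (Fp L) L (IsCMField.complexConj L) (n + n) (hermD L e dV hdV dW hdW) v.1
                (UnitaryGroup.finPart (Fp L) L (IsCMField.complexConj L) (n + n) (hermD L e dV hdV dW hdW) (weylDelta L e dV hdV dW hdW)) *
              ((p.2 v : ↥(unipDeltaLoc L e dV hdV dW hdW v.1)) : UnitaryGroup.localPi L (IsCMField.complexConj L) (n + n) (hermD L e dV hdV dW hdW) v.1) *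
              UnitaryGroup.evalPlace (Fp L) L (IsCMField.complexConj L) (n + n) (hermD L e dV hdV dW hdW) v.1
                (UnitaryGroup.finPart (Fp L) L (IsCMField.complexConj L) (n + n) (hermD L e dV hdV dW hdW) h)))) ((νinf (kindWFinset L e dV hdV dW hdW T₀ S h)).prod (Measure.pi fun v : (kindWFinset L e dV hdV dW hdW T₀ S h) => νv v.1)))
    {Finf : Fin m → ℂ} {Ffin : Fin m → HeightOneSpectrum (𝓞 (Fp L)) → ℂ}
    (hFinf : ∀ j, Finf j = ∫ a, conj (unipDeltaChar L e dV hdV dW hdW S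
            (UnitaryGroup.archToAdelic (Fp L) L (IsCMField.complexConj L) (n + n) (hermD L e dV hdV dW hdW)
              (a : UnitaryGroup.arch (Fp L) L (IsCMField.complexConj L) (n + n) (hermD L e dV hdV dW hdW))) : ℂ) *
          FinfT j s (UnitaryGroup.archPart (Fp L) L (IsCMField.complexConj L) (n + n) (hermD L e dV hdV dW hdW) (weylDelta L e dV hdV dW hdW) *
              (a : UnitaryGroup.arch (Fp L) L (IsCMField.complexConj L) (n + n) (hermD L e dV hdV dW hdW)) *
              UnitaryGroup.archPart (Fp L) L (IsCMField.complexConj L) (n + n) (hermD L e dV hdV dW hdW) h) ∂(νinf (kindWFinset L e dV hdV dW hdW T₀ S h)))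
    (hFfin : ∀ j (v : (kindWFinset L e dV hdV dW hdW T₀ S h)), Ffin j v.1 = ∫ y, conj (unipDeltaChar L e dV hdV dW hdW S
            (locToAdelic L e dV hdV dW hdW v.1
              ((y : ↥(unipDeltaLoc L e dV hdV dW hdW v.1)) : UnitaryGroup.localPi L (IsCMField.complexConj L) (n + n) (hermD L e dV hdV dW hdW) v.1)) : ℂ) *
          FvT j v s (UnitaryGroup.evalPlace (Fp L) L (IsCMField.complexConj L) (n + n) (hermD L e dV hdV dW hdW) v.1
                (UnitaryGroup.finPart (Fp L) L (IsCMField.complexConj L) (n + n) (hermD L e dV hdV dW hdW) (weylDelta L e dV hdV dW hdW)) *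
              ((y : ↥(unipDeltaLoc L e dV hdV dW hdW v.1)) : UnitaryGroup.localPi L (IsCMField.complexConj L) (n + n) (hermD L e dV hdV dW hdW) v.1) *
              UnitaryGroup.evalPlace (Fp L) L (IsCMField.complexConj L) (n + n) (hermD L e dV hdV dW hdW) v.1
                (UnitaryGroup.finPart (Fp L) L (IsCMField.complexConj L) (n + n) (hermD L e dV hdV dW hdW) h)) ∂(νv v.1)) :
    kindWPart L e dV hdV dW hdW (kindWFinset L e dV hdV dW hdW T₀ S h) (νinf (kindWFinset L e dV hdV dW hdW T₀ S h)) νv (fT (kindWFinset L e dV hdV dW hdW T₀ S h)) S s h = ∑ j, Finf j * ∏ v ∈ (kindWFinset L e dV hdV dW hdW T₀ S h), Ffin j v := by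
  haveI := hσ (kindWFinset L e dV hdV dW hdW T₀ S h)
  have hF := jointWhittaker_eq_sum_mul_prod_of_sum_tensor L e dV hdV dW hdW (kindWFinset L e dV hdV dW hdW T₀ S h) (νinf (kindWFinset L e dV hdV dW hdW T₀ S h)) νv hsum S s h hint
  refine (show kindWPart L e dV hdV dW hdW (kindWFinset L e dV hdV dW hdW T₀ S h) (νinf (kindWFinset L e dV hdV dW hdW T₀ S h)) νv (fT (kindWFinset L e dV hdV dW hdW T₀ S h)) S s h = _ from hF).trans (Finset.sum_congr rfl fun j _ => ?_)
  rw [hFinf j, ← Finset.prod_coe_sort (kindWFinset L e dV hdV dW hdW T₀ S h) (fun v => Ffin j v)]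
  exact congrArg (fun z => _ * z) (Finset.prod_congr rfl fun v _ => (hFfin j v).symm)

/-! ## §2 The letter `hPart` of the ∃-head, verbatim -/

set_option maxHeartbeats 400000 in
/-- **THE LETTER `hPart` OF ★ `exists_kindW_eulerLetters_of_letters`, FROM THE ∀-QUANTIFIED LOCAL LETTERS** (Σ⊗ structure at every `(S,h)`, summand integrability and
«continued = integral» on `{n∕2 < re s}` at non-singular indices). [cite: KudlaRallis1994, §1] [cite: Tan1999, §2–§3] -/
theorem hPart_of_letters (T₀ : Finset (HeightOneSpectrum (𝓞 (Fp L))))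
    (νinf : Finset (HeightOneSpectrum (𝓞 (Fp L))) → Measure ↥(unipDeltaArch L e dV hdV dW hdW)) (hσ : ∀ T, SigmaFinite (νinf T))
    (νv : ∀ v : HeightOneSpectrum (𝓞 (Fp L)), Measure ↥(unipDeltaLoc L e dV hdV dW hdW v)) [∀ v, SigmaFinite (νv v)]
    {fT : ∀ T : Finset (HeightOneSpectrum (𝓞 (Fp L))), ℂ → UnitaryGroup.arch (Fp L) L (IsCMField.complexConj L) (n + n) (hermD L e dV hdV dW hdW) × (Π v : T, UnitaryGroup.localPi L (IsCMField.complexConj L) (n + n) (hermD L e dV hdV dW hdW) v.1) → ℂ}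
    {m : ℕ}
    (FinfT : Fin m → skewMatrices ((IsCMField.complexConj L : L ≃ₐ[Fp L] L) : L →+* L) ((gramR L e dV hdV dW hdW).map (algebraMap (Fp L) L)) → HA L e dV hdV dW hdW → ℂ → UnitaryGroup.arch (Fp L) L (IsCMField.complexConj L) (n + n) (hermD L e dV hdV dW hdW) → ℂ)
    (FvT : Fin m → ∀ (S : skewMatrices ((IsCMField.complexConj L : L ≃ₐ[Fp L] L) : L →+* L) ((gramR L e dV hdV dW hdW).map (algebraMap (Fp L) L))) (h : HA L e dV hdV dW hdW) (v : (kindWFinset L e dV hdV dW hdW T₀ (S : Matrix (Fin n) (Fin n) L) h)), ℂ → UnitaryGroup.localPi L (IsCMField.complexConj L) (n + n) (hermD L e dV hdV dW hdW) v.1 → ℂ)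
    (hsum : ∀ (S : skewMatrices ((IsCMField.complexConj L : L ≃ₐ[Fp L] L) : L →+* L) ((gramR L e dV hdV dW hdW).map (algebraMap (Fp L) L))) (h : HA L e dV hdV dW hdW) (s : ℂ) (a : UnitaryGroup.arch (Fp L) L (IsCMField.complexConj L) (n + n) (hermD L e dV hdV dW hdW)) (x : Π v : (kindWFinset L e dV hdV dW hdW T₀ (S : Matrix (Fin n) (Fin n) L) h), UnitaryGroup.localPi L (IsCMField.complexConj L) (n + n) (hermD L e dV hdV dW hdW) v.1),
      fT (kindWFinset L e dV hdV dW hdW T₀ (S : Matrix (Fin n) (Fin n) L) h) s (a, x) = ∑ j, FinfT j S h s a * ∏ v : (kindWFinset L e dV hdV dW hdW T₀ (S : Matrix (Fin n) (Fin n) L) h), FvT j S h v s (x v))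
    (hint : ∀ (S : skewMatrices ((IsCMField.complexConj L : L ≃ₐ[Fp L] L) : L →+* L) ((gramR L e dV hdV dW hdW).map (algebraMap (Fp L) L))) (h : HA L e dV hdV dW hdW) (s : ℂ) (j : Fin m), (n : ℝ) / 2 < s.re → (S : Matrix (Fin n) (Fin n) L).det ≠ 0 →
      Integrable (fun p : ↥(unipDeltaArch L e dV hdV dW hdW) × (Π v : (kindWFinset L e dV hdV dW hdW T₀ (S : Matrix (Fin n) (Fin n) L) h), ↥(unipDeltaLoc L e dV hdV dW hdW v.1)) =>
      (conj (unipDeltaChar L e dV hdV dW hdW (S : Matrix (Fin n) (Fin n) L)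
            (UnitaryGroup.archToAdelic (Fp L) L (IsCMField.complexConj L) (n + n) (hermD L e dV hdV dW hdW)
              (p.1 : UnitaryGroup.arch (Fp L) L (IsCMField.complexConj L) (n + n) (hermD L e dV hdV dW hdW))) : ℂ) *
          ∏ v : (kindWFinset L e dV hdV dW hdW T₀ (S : Matrix (Fin n) (Fin n) L) h), conj (unipDeltaChar L e dV hdV dW hdW (S : Matrix (Fin n) (Fin n) L)
            (locToAdelic L e dV hdV dW hdW v.1
              ((p.2 v : ↥(unipDeltaLoc L e dV hdV dW hdW v.1)) : UnitaryGroup.localPi L (IsCMField.complexConj L) (n + n) (hermD L e dV hdV dW hdW) v.1)) : ℂ)) *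
        (FinfT j S h s (UnitaryGroup.archPart (Fp L) L (IsCMField.complexConj L) (n + n) (hermD L e dV hdV dW hdW) (weylDelta L e dV hdV dW hdW) *
              (p.1 : UnitaryGroup.arch (Fp L) L (IsCMField.complexConj L) (n + n) (hermD L e dV hdV dW hdW)) *
              UnitaryGroup.archPart (Fp L) L (IsCMField.complexConj L) (n + n) (hermD L e dV hdV dW hdW) h) *
          ∏ v : (kindWFinset L e dV hdV dW hdW T₀ (S : Matrix (Fin n) (Fin n) L) h), FvT j S h v s (UnitaryGroup.evalPlace (Fp L) L (IsCMField.complexConj L) (n + n) (hermD L e dV hdV dW hdW) v.1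
                (UnitaryGroup.finPart (Fp L) L (IsCMField.complexConj L) (n + n) (hermD L e dV hdV dW hdW) (weylDelta L e dV hdV dW hdW)) *
              ((p.2 v : ↥(unipDeltaLoc L e dV hdV dW hdW v.1)) : UnitaryGroup.localPi L (IsCMField.complexConj L) (n + n) (hermD L e dV hdV dW hdW) v.1) *
              UnitaryGroup.evalPlace (Fp L) L (IsCMField.complexConj L) (n + n) (hermD L e dV hdV dW hdW) v.1
                (UnitaryGroup.finPart (Fp L) L (IsCMField.complexConj L) (n + n) (hermD L e dV hdV dW hdW) h)))) ((νinf (kindWFinset L e dV hdV dW hdW T₀ (S : Matrix (Fin n) (Fin n) L) h)).prod (Measure.pi fun v : (kindWFinset L e dV hdV dW hdW T₀ (S : Matrix (Fin n) (Fin n) L) h) => νv v.1)))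
    (Finf : Fin m → skewMatrices ((IsCMField.complexConj L : L ≃ₐ[Fp L] L) : L →+* L) ((gramR L e dV hdV dW hdW).map (algebraMap (Fp L) L)) → ℂ → HA L e dV hdV dW hdW → ℂ)
    (Ffin : Fin m → skewMatrices ((IsCMField.complexConj L : L ≃ₐ[Fp L] L) : L →+* L) ((gramR L e dV hdV dW hdW).map (algebraMap (Fp L) L)) → HA L e dV hdV dW hdW → HeightOneSpectrum (𝓞 (Fp L)) → ℂ → ℂ)
    (hFinf : ∀ (j : Fin m) (S : skewMatrices ((IsCMField.complexConj L : L ≃ₐ[Fp L] L) : L →+* L) ((gramR L e dV hdV dW hdW).map (algebraMap (Fp L) L))) (h : HA L e dV hdV dW hdW) (s : ℂ), (n : ℝ) / 2 < s.re → (S : Matrix (Fin n) (Fin n) L).det ≠ 0 →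
      Finf j S s h = ∫ a, conj (unipDeltaChar L e dV hdV dW hdW (S : Matrix (Fin n) (Fin n) L)
            (UnitaryGroup.archToAdelic (Fp L) L (IsCMField.complexConj L) (n + n) (hermD L e dV hdV dW hdW)
              (a : UnitaryGroup.arch (Fp L) L (IsCMField.complexConj L) (n + n) (hermD L e dV hdV dW hdW))) : ℂ) *
          FinfT j S h s (UnitaryGroup.archPart (Fp L) L (IsCMField.complexConj L) (n + n) (hermD L e dV hdV dW hdW) (weylDelta L e dV hdV dW hdW) *
              (a : UnitaryGroup.arch (Fp L) L (IsCMField.complexConj L) (n + n) (hermD L e dV hdV dW hdW)) *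
              UnitaryGroup.archPart (Fp L) L (IsCMField.complexConj L) (n + n) (hermD L e dV hdV dW hdW) h) ∂(νinf (kindWFinset L e dV hdV dW hdW T₀ (S : Matrix (Fin n) (Fin n) L) h)))
    (hFfin : ∀ (j : Fin m) (S : skewMatrices ((IsCMField.complexConj L : L ≃ₐ[Fp L] L) : L →+* L) ((gramR L e dV hdV dW hdW).map (algebraMap (Fp L) L))) (h : HA L e dV hdV dW hdW) (v : (kindWFinset L e dV hdV dW hdW T₀ (S : Matrix (Fin n) (Fin n) L) h)) (s : ℂ), (n : ℝ) / 2 < s.re → (S : Matrix (Fin n) (Fin n) L).det ≠ 0 →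
      Ffin j S h v.1 s = ∫ y, conj (unipDeltaChar L e dV hdV dW hdW (S : Matrix (Fin n) (Fin n) L)
            (locToAdelic L e dV hdV dW hdW v.1
              ((y : ↥(unipDeltaLoc L e dV hdV dW hdW v.1)) : UnitaryGroup.localPi L (IsCMField.complexConj L) (n + n) (hermD L e dV hdV dW hdW) v.1)) : ℂ) *
          FvT j S h v s (UnitaryGroup.evalPlace (Fp L) L (IsCMField.complexConj L) (n + n) (hermD L e dV hdV dW hdW) v.1
                (UnitaryGroup.finPart (Fp L) L (IsCMField.complexConj L) (n + n) (hermD L e dV hdV dW hdW) (weylDelta L e dV hdV dW hdW)) *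
              ((y : ↥(unipDeltaLoc L e dV hdV dW hdW v.1)) : UnitaryGroup.localPi L (IsCMField.complexConj L) (n + n) (hermD L e dV hdV dW hdW) v.1) *
              UnitaryGroup.evalPlace (Fp L) L (IsCMField.complexConj L) (n + n) (hermD L e dV hdV dW hdW) v.1
                (UnitaryGroup.finPart (Fp L) L (IsCMField.complexConj L) (n + n) (hermD L e dV hdV dW hdW) h)) ∂(νv v.1)) :
    ∀ (S : skewMatrices ((IsCMField.complexConj L : L ≃ₐ[Fp L] L) : L →+* L) ((gramR L e dV hdV dW hdW).map (algebraMap (Fp L) L))) (h : HA L e dV hdV dW hdW) (s : ℂ),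
      (n : ℝ) / 2 < s.re → (S : Matrix (Fin n) (Fin n) L).det ≠ 0 →
      kindWPart L e dV hdV dW hdW (kindWFinset L e dV hdV dW hdW T₀ (S : Matrix (Fin n) (Fin n) L) h) (νinf (kindWFinset L e dV hdV dW hdW T₀ (S : Matrix (Fin n) (Fin n) L) h)) νv (fT (kindWFinset L e dV hdV dW hdW T₀ (S : Matrix (Fin n) (Fin n) L) h)) (S : Matrix (Fin n) (Fin n) L) s h =
        ∑ j, Finf j S s h * ∏ v ∈ (kindWFinset L e dV hdV dW hdW T₀ (S : Matrix (Fin n) (Fin n) L) h), Ffin j S h v s :=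
  fun S h s hs hdet =>
    kindWPart_eq_sum_mul_prod_of_letters L e dV hdV dW hdW T₀ νinf hσ νv (S : Matrix (Fin n) (Fin n) L) h s (hsum S h) (fun j => hint S h s j hs hdet)
      (Finf := fun j => Finf j S s h) (Ffin := fun j v => Ffin j S h v s)
      (fun j => hFinf j S h s hs hdet) (fun j v => hFfin j S h v s hs hdet)

end Summit.HodgeConjecture.HodgeConjecture.Cruxes.HLiu418.K2LiuSiegelEisensteinKindWPartOfLetters

end
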